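import Literature.Geometry.Symplectic.LegendrianDarbouxChart
import HarnessLib

/-!
# Darboux's theorem at every boundary point of a Stein domain; Legendrian arcs through every point

Topic `Literature/Geometry/Symplectic`; infrastructure for the inline proof obligation of the fact
`Literature.Geometry.Symplectic.akbulut_matveyev` (Akbulut–Matveyev 1998, Thm. 3), whose first step
(§4 of the paper: *"Since every curve in contact manifold is isotopic to a Legendrian curve via
smooth `C⁰`-small isotopy, we can assume that 2-handles … are attached to Legendrian knots"*;
Gompf 1998, §1) is the Legendrian realisation of ARBITRARY knots of `∂W`, carried out box by box in
Darboux charts around arbitrary points of the knot.  The tree has Darboux boxes only along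
Legendrian knots (`LegendrianDarbouxChart.lean`: the structure `LegendrianArc` is a Legendrian
KNOT with a base parameter, and the Darboux box of `LegendrianDarbouxBox.lean` is built along its
arc).  This file removes that hypothesis: **every boundary point `p` of a compact Stein domain,
with any prescribed non-zero complex tangency `V₀ ∈ ξ_p`, carries Darboux data** — the missing
Legendrian arc through `p` in the direction `V₀` is produced as an integral curve of a Legendrian
vector field — hence a Darboux box `Ψ^*α = g (dz - y dx)`, `g > 0`, and, read back in `W`,
**Darboux's theorem for the contact boundary of a Stein domain** (Geiges 2008, Thm. 2.5.1, in the
conformal form `ψ^*α = g · α_std` which is all that the elementary "straighten a Legendrian field,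
take the slope as a coordinate" proof of `LegendrianDarbouxBox.lean` gives and all that is needed
for Legendrian questions).  Everything is **proved**; no named fact is introduced.

## Contents (namespace `Literature.Geometry.Symplectic.LegendrianDarboux.BasePoint`)

* `BasePoint S` — a boundary point `p` of the compact Stein domain `(W, S)` with a non-zero
  `V₀ ∈ ξ_p`; `BasePoint.ofBoundaryPoint` chooses `V₀` (`ξ_p` is `2`-dimensional).
* §1 (the chart layer of `LegendrianDarbouxChart.lean`, for a base point instead of a knot): the
  affine parametrisation `emb w = chart p + (0, w)` of the boundary hyperplane of the chart at `p`,
  its domain `U`, the contact form `αc` on `U ⊆ ℝ³` (smooth), `u₁ = proj3 V₀`, `u₀ = proj3 (J V₀)`,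
  a transverse `r₀` (`αc₀ r₀ > 0`), and the contact condition `dαc₀(u₁, u₀) = ω_p(V₀, J V₀) > 0`.
* §2 (new) **the Legendrian arc through `p`**: the Legendrian field
  `Yv w = αc_w(r₀) u₁ - αc_w(u₁) r₀` (`αc(Yv) = 0`, `Yv 0 = αc₀(r₀) u₁`), its local smooth flow
  (the tree's `Literature.Analysis.ODE.exists_contDiffOn_flow`, Lang 1995, IV §1), the integral
  curve `c` through `0`: smooth, Legendrian, `ċ(0) = αc₀(r₀) u₁`; whence
  `twist_pos : 0 < dαc₀(ċ(0), u₀)` and **`BasePoint.darbouxData : DarbouxData`**.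
* §3 (the chart-`p` dictionary of `LegendrianStabilisation.lean`, Part 1, for a base point):
  `pt`, `M`, `M_apply_zero_iff`, `contactForm_M`, `kahlerForm_M`, the box frame `bv`, the box
  point `bpt`, `contactForm_bv : α(bv w ξ) = g(w) (ξ₂ - w₁ ξ₀)`, `kahlerForm_bv`.
* §4 (new) **Darboux's theorem in `W`**: the box map `bpt : ℝ³ ⊇ V → W` is `C^∞`, injective, takes
  values in `∂W`, has injective differential `bv w` (`hasMFDerivAt_bpt`), `bpt 0 = p`, and pulls
  the contact form back to `g (dz - y dx)` (`SteinStructure.exists_darbouxChart`); and **the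
  Legendrian arc through `p` in the direction `V₀`** (`SteinStructure.exists_legendrianArc`).

## References

* H. Geiges, *An Introduction to Contact Topology*, CUP (2008), Thm. 2.5.1 (Darboux's theorem),
  §3.3 (Legendrian approximation works in Darboux charts). [folklore]
* S. Akbulut, R. Matveyev, *A convex decomposition theorem for 4-manifolds*, IMRN 1998, §4.
  [AkbulutMatveyev1998]
* R. E. Gompf, *Handlebody construction of Stein surfaces*, Ann. of Math. 148 (1998), §1.
  [Gompf1998]
* S. Lang, *Differential and Riemannian Manifolds* (1995), Ch. IV §1. [Lang1995]
-/

noncomputable section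

open scoped Manifold ContDiff Topology
open Set Function Metric
open Literature.Geometry.Kaehler Literature.Topology.FourManifolds

namespace Literature.Geometry.Symplectic

/-- `ℝ⁴`, the model of the tangent spaces. -/
local notation "E4" => EuclideanSpace ℝ (Fin 4)
/-- `ℝ³`. -/
local notation "E3" => EuclideanSpace ℝ (Fin 3)

namespace LegendrianDarboux

variable {W : Type*} [TopologicalSpace W] [ChartedSpace (EuclideanHalfSpace 4) W]
  [IsManifold (𝓡∂ 4) ∞ W] [CompactSpace W]

/-- **A boundary point of a compact Stein domain with a non-zero complex tangency** `V₀ ∈ ξ_p`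
(the direction of the Legendrian arc to be drawn through `p`). [folklore] -/
structure BasePoint (S : SteinStructure W) where
  /-- the base point -/
  p : W
  /-- it is a boundary point -/
  isBoundaryPoint_p : (𝓡∂ 4).IsBoundaryPoint p
  /-- the direction -/
  V₀ : E4
  /-- it is a complex tangency -/
  V₀_mem : V₀ ∈ contactPlane S.J p
  /-- it is non-zero -/
  V₀_ne_zero : V₀ ≠ 0

namespace BasePoint

variable {S : SteinStructure W}

/-- Every boundary point has a non-zero complex tangency (`ξ_p` is `2`-dimensional). [folklore] -/
theorem exists_mem_contactPlane_ne_zero (S : SteinStructure W) (p : W) :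
    ∃ V ∈ contactPlane S.J p, V ≠ 0 := by
  apply Submodule.exists_mem_ne_zero_of_ne_bot
  intro h
  have h2 := S.finrank_contactPlane p
  rw [h, finrank_bot] at h2
  exact absurd h2 (by norm_num)

/-- **The base point structure at an arbitrary boundary point** (choosing a direction).
[folklore] -/
def ofBoundaryPoint (S : SteinStructure W) {p : W} (hp : (𝓡∂ 4).IsBoundaryPoint p) : BasePoint S where
  p := p
  isBoundaryPoint_p := hp
  V₀ := Classical.choose (exists_mem_contactPlane_ne_zero S p)
  V₀_mem := (Classical.choose_spec (exists_mem_contactPlane_ne_zero S p)).1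
  V₀_ne_zero := (Classical.choose_spec (exists_mem_contactPlane_ne_zero S p)).2

/-- The base point of `ofBoundaryPoint`. [folklore] -/
@[simp] theorem ofBoundaryPoint_p (S : SteinStructure W) {p : W} (hp : (𝓡∂ 4).IsBoundaryPoint p) :
    (ofBoundaryPoint S hp).p = p := rfl

variable (B : BasePoint S)

/-! ## §1 The chart layer at a base point -/

/-- The extended chart at the base point. [folklore] -/
def chart : PartialEquiv W E4 := extChartAt (𝓡∂ 4) B.p

/-- Unfolding `chart`. [folklore] -/
theorem chart_def : B.chart = extChartAt (𝓡∂ 4) B.p := rfl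

/-- The base point lies in its chart source. [folklore] -/
theorem p_mem_source : B.p ∈ (chartAt (EuclideanHalfSpace 4) B.p).source := mem_chart_source _ _

/-- The base point has vanishing `0`-th chart coordinate. [folklore] -/
theorem chart_p_zero : B.chart B.p 0 = 0 :=
  (isBoundaryPoint_iff_apply_zero B.p_mem_source).1 B.isBoundaryPoint_p

/-- **The affine parametrisation of the boundary hyperplane through the base point**:
`emb w = chart p + (0, w)`. [folklore] -/
def emb (w : E3) : E4 := B.chart B.p + L3 w

/-- `emb 0 = chart p`. [folklore] -/
@[simp] theorem emb_zero : B.emb 0 = B.chart B.p := by simp [emb]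

/-- The hyperplane points have vanishing `0`-th coordinate. [folklore] -/
theorem emb_apply_zero (w : E3) : B.emb w 0 = 0 := by
  simp [emb, B.chart_p_zero]

/-- The hyperplane lies in the closed half-space `range (𝓡∂ 4)`. [folklore] -/
theorem emb_mem_range (w : E3) : B.emb w ∈ range (𝓡∂ 4) := by
  rw [range_modelWithCornersEuclideanHalfSpace]
  exact le_of_eq (B.emb_apply_zero w).symm

/-- The derivative of `emb` is `L3`. [folklore] -/
theorem hasFDerivAt_emb (w : E3) : HasFDerivAt B.emb L3 w := by
  show HasFDerivAt (fun w => B.chart B.p + L3 w) L3 w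
  exact (L3.hasFDerivAt (x := w)).const_add (B.chart B.p)

/-- `emb` is smooth. [folklore] -/
theorem contDiff_emb : ContDiff ℝ ∞ B.emb := contDiff_const.add L3.contDiff

/-- `emb` is continuous. [folklore] -/
theorem continuous_emb : Continuous B.emb := B.contDiff_emb.continuous

/-- `emb` is injective. [folklore] -/
theorem emb_injective : Injective B.emb := fun _ _ h => L3_injective (add_left_cancel h)

/-- **The domain `U`**: parameters whose hyperplane point lies in the chart target. [folklore] -/
def U : Set E3 := B.emb ⁻¹' B.chart.target

/-- `U` is open. [folklore] -/
theorem isOpen_U : IsOpen B.U := by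
  have h : B.U = B.emb ⁻¹' ((𝓡∂ 4).symm ⁻¹' (chartAt (EuclideanHalfSpace 4) B.p).target) := by
    ext w
    simp only [U, chart, extChartAt_target, mem_preimage, mem_inter_iff, B.emb_mem_range w, and_true]
  rw [h]
  exact ((chartAt (EuclideanHalfSpace 4) B.p).open_target.preimage (𝓡∂ 4).continuous_symm).preimage
    B.continuous_emb

/-- `0 ∈ U`. [folklore] -/
theorem zero_mem_U : (0 : E3) ∈ B.U := by
  simp only [U, mem_preimage, emb_zero, chart]
  exact mem_extChartAt_target _

/-- `U` is a neighbourhood of `0`. [folklore] -/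
theorem U_mem_nhds_zero : B.U ∈ 𝓝 (0 : E3) := B.isOpen_U.mem_nhds B.zero_mem_U

/-- Points of `U` embed into the chart target. [folklore] -/
theorem emb_mem_target {w : E3} (hw : w ∈ B.U) : B.emb w ∈ B.chart.target := hw

/-- Points of `U` come from the chart source. [folklore] -/
theorem symm_emb_mem_source {w : E3} (hw : w ∈ B.U) :
    B.chart.symm (B.emb w) ∈ (chartAt (EuclideanHalfSpace 4) B.p).source := by
  have := B.chart.map_target hw
  rwa [chart, extChartAt_source] at this

/-! ### The contact form read in the chart -/

/-- The chart representative `α̂` of the contact form `αM S = -d^ℂφ` in the chart at the base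
point. [folklore] -/
def αhat : E4 → E4 [⋀^Fin 1]→L[ℝ] ℝ := (LegendrianArc.αM S).inChart B.p

/-- **The contact form on `ℝ³`**: `αc w v = α̂_{emb w}(0, v)`. [folklore] -/
def αc (w : E3) : E3 →L[ℝ] ℝ :=
  (ContinuousAlternatingMap.ofSubsingleton ℝ E3 ℝ (0 : Fin 1)).symm
    ((B.αhat (B.emb w)).compContinuousLinearMap L3)

/-- `αc`, evaluated. [folklore] -/
theorem αc_apply (w v : E3) : B.αc w v = B.αhat (B.emb w) ![L3 v] := by
  rw [αc, ContinuousAlternatingMap.ofSubsingleton_symm_apply_apply,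
    ContinuousAlternatingMap.compContinuousLinearMap_apply]
  congr 1
  funext i; fin_cases i; rfl

/-- At the centre of the chart, `α̂` is `α`. [folklore] -/
theorem αhat_chart_p (v : Fin 1 → E4) : B.αhat (B.chart B.p) v = LegendrianArc.αM S B.p v := by
  rw [αhat, chart, MForm.inChart_apply_self]
  rfl

/-- `αc 0 v = α_p(0, v)`. [folklore] -/
theorem αc_zero_apply (v : E3) : B.αc 0 v = S.contactForm B.p (L3 v) := by
  rw [αc_apply, emb_zero, αhat_chart_p]; rfl

/-- The pulled-back `1`-form `x ↦ α̂_{emb x} ∘ L3` on `ℝ³`. [folklore] -/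
def αpull (x : E3) : E3 [⋀^Fin 1]→L[ℝ] ℝ := (B.αhat (B.emb x)).compContinuousLinearMap L3

/-- The pulled-back form is the `1`-form of `αc`. [folklore] -/
theorem αpull_eq (x : E3) :
    B.αpull x = ContinuousAlternatingMap.ofSubsingleton ℝ E3 ℝ (0 : Fin 1) (B.αc x) := by
  rw [αc, Equiv.apply_symm_apply]; rfl

/-! ### The vectors `u₁ = V₀`, `u₀ = J V₀` and `r₀` read in `ℝ³` -/

/-- `J V₀ ∈ ξ`. [folklore] -/
theorem JV₀_mem : S.J B.p B.V₀ ∈ contactPlane S.J B.p := (S.J_mem_contactPlane_iff _ _).2 B.V₀_mem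

/-- `V₀` is tangent to the boundary. [folklore] -/
theorem V₀_apply_zero : B.V₀ 0 = 0 := B.V₀_mem.1

/-- `J V₀` is tangent to the boundary. [folklore] -/
theorem JV₀_apply_zero : S.J B.p B.V₀ 0 = 0 := B.JV₀_mem.1

/-- **`u₁ = V₀`** read in `ℝ³` (the direction of the arc). [folklore] -/
def u₁ : E3 := proj3 B.V₀

/-- **`u₀ = J V₀`** read in `ℝ³`. [folklore] -/
def u₀ : E3 := proj3 (S.J B.p B.V₀)

/-- `L3 u₁ = V₀`. [folklore] -/
theorem L3_u₁ : L3 B.u₁ = B.V₀ := L3_proj3 B.V₀_apply_zero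

/-- `L3 u₀ = J V₀`. [folklore] -/
theorem L3_u₀ : L3 B.u₀ = S.J B.p B.V₀ := L3_proj3 B.JV₀_apply_zero

/-- `u₁ ≠ 0`. [folklore] -/
theorem u₁_ne_zero : B.u₁ ≠ 0 := fun h => B.V₀_ne_zero (by rw [← B.L3_u₁, h, map_zero])

/-- **`αc₀(u₁) = 0`** (`V₀ ∈ ξ`). [folklore] -/
theorem αc_zero_u₁ : B.αc 0 B.u₁ = 0 := by
  rw [αc_zero_apply, L3_u₁]
  exact S.contactForm_apply_eq_zero B.isBoundaryPoint_p B.V₀_mem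

/-- **`αc₀(u₀) = 0`** (`J V₀ ∈ ξ`). [folklore] -/
theorem αc_zero_u₀ : B.αc 0 B.u₀ = 0 := by
  rw [αc_zero_apply, L3_u₀]
  exact S.contactForm_apply_eq_zero B.isBoundaryPoint_p B.JV₀_mem

/-- **There is a boundary tangent vector on which the contact form is positive** (`T∂W` is
`3`-dimensional and the contact plane only `2`-dimensional). [folklore] -/
theorem exists_contactForm_pos : ∃ R : E4, R 0 = 0 ∧ 0 < S.contactForm B.p R := by
  by_contra h
  push Not at h
  have hzero : ∀ R : E4, R 0 = 0 → S.contactForm B.p R = 0 := fun R hR => by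
    have h1 := h R hR
    have h2 := h (-R) (by simp [hR])
    rw [map_neg] at h2
    linarith
  have hle : boundaryTangentSpace ≤ contactPlane S.J B.p := fun R hR =>
    S.mem_contactPlane_of_contactForm_eq_zero B.isBoundaryPoint_p hR (hzero R hR)
  have := Submodule.finrank_mono hle
  rw [LegendrianArc.finrank_boundaryTangentSpace, S.finrank_contactPlane] at this
  omega

/-- A boundary tangent vector with `α_p(R₀) > 0`. [folklore] -/
def R₀ : E4 := Classical.choose B.exists_contactForm_pos

/-- `R₀` is tangent to the boundary. [folklore] -/
theorem R₀_apply_zero : B.R₀ 0 = 0 := (Classical.choose_spec B.exists_contactForm_pos).1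

/-- `α_p(R₀) > 0`. [folklore] -/
theorem contactForm_R₀_pos : 0 < S.contactForm B.p B.R₀ :=
  (Classical.choose_spec B.exists_contactForm_pos).2

/-- **`r₀`**: the transverse vector read in `ℝ³`. [folklore] -/
def r₀ : E3 := proj3 B.R₀

/-- `L3 r₀ = R₀`. [folklore] -/
theorem L3_r₀ : L3 B.r₀ = B.R₀ := L3_proj3 B.R₀_apply_zero

/-- **`αc₀(r₀) > 0`.** [folklore] -/
theorem αc_zero_r₀_pos : 0 < B.αc 0 B.r₀ := by
  rw [αc_zero_apply, L3_r₀]; exact B.contactForm_R₀_pos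

/-! ### Smoothness of the contact form in the chart and the contact condition (Hausdorff `W`) -/

section Smooth

variable [T2Space W]

/-- `α̂` is `C^∞` within the half-space at every point of the chart target. [folklore] -/
theorem contDiffWithinAt_αhat {y : E4} (hy : y ∈ B.chart.target) :
    ContDiffWithinAt ℝ ∞ B.αhat (range (𝓡∂ 4)) y := by
  have hz : B.chart.symm y ∈ (extChartAt (𝓡∂ 4) B.p).source := B.chart.map_target hy
  have h := MForm.SmoothAt.contDiffWithinAt_inChart (α := LegendrianArc.αM S) (I := 𝓡∂ 4) hz
    ((isSmoothForm_iff_smoothAt _).1 LegendrianArc.isSmoothForm_αM _)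
  rwa [show extChartAt (𝓡∂ 4) B.p (B.chart.symm y) = y from B.chart.right_inv hy] at h

/-- `αc` is smooth at the points of `U`. [folklore] -/
theorem contDiffAt_αc {w : E3} (hw : w ∈ B.U) : ContDiffAt ℝ ∞ B.αc w := by
  have h1 : ContDiffAt ℝ ∞ (fun w => B.αhat (B.emb w)) w := by
    have := (B.contDiffWithinAt_αhat hw).comp (s := univ) w B.contDiff_emb.contDiffAt.contDiffWithinAt
      (fun x _ => B.emb_mem_range x)
    exact this.contDiffAt Filter.univ_mem
  have h2 : ContDiffAt ℝ ∞ (fun w => ContinuousAlternatingMap.compContinuousLinearMapCLM L3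
      (B.αhat (B.emb w))) w :=
    (ContinuousAlternatingMap.compContinuousLinearMapCLM (ι := Fin 1) (F := ℝ) L3).contDiff.contDiffAt.comp
      w h1
  exact (ContinuousAlternatingMap.ofSubsingletonLIE (𝕜 := ℝ) (E := E3) (F := ℝ) (ι := Fin 1)
    0).symm.toContinuousLinearEquiv.contDiff.contDiffAt.comp w h2

/-- `αc` is smooth on `U`. [folklore] -/
theorem contDiffOn_αc : ContDiffOn ℝ ∞ B.αc B.U := fun _ hw => (B.contDiffAt_αc hw).contDiffWithinAt

/-- Naturality of `d` under the affine embedding, at any point of `U`: the exterior derivative of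
the pulled-back form is the exterior derivative of `α̂` within the half-space, on embedded
vectors. [folklore] -/
theorem extDeriv_αpull {x : E3} (hx : x ∈ B.U) (u v : E3) :
    extDeriv B.αpull x ![u, v] = extDerivWithin B.αhat (range (𝓡∂ 4)) (B.emb x) ![L3 u, L3 v] := by
  have hdiff : DifferentiableWithinAt ℝ B.αhat (range (𝓡∂ 4)) (B.emb x) :=
    (B.contDiffWithinAt_αhat hx).differentiableWithinAt (by simp)
  have h := extDerivWithin_pullback (𝕜 := ℝ) (n := 1) (r := ∞) (s := univ) (x := x)
    (t := range (𝓡∂ 4)) (f := B.emb) hdiff B.contDiff_emb.contDiffAt.contDiffWithinAt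
    (by rw [minSmoothness_of_isRCLikeNormedField]; exact WithTop.coe_le_coe.2 le_top)
    uniqueDiffOn_univ (by simp) (mem_univ _) (fun x _ => B.emb_mem_range x)
  simp only [fderivWithin_univ, extDerivWithin_univ, (B.hasFDerivAt_emb _).fderiv] at h
  have h1 : (fun x => (B.αhat (B.emb x)).compContinuousLinearMap L3) = B.αpull := rfl
  rw [h1] at h
  rw [h, ContinuousAlternatingMap.compContinuousLinearMap_apply]
  congr 1
  funext i; fin_cases i <;> rfl

/-- `dαc` is `dα̂` on embedded vectors, at any point of `U`. [folklore] -/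
theorem dα_αc_eq {x : E3} (hx : x ∈ B.U) (u v : E3) :
    dα B.αc x u v = extDerivWithin B.αhat (range (𝓡∂ 4)) (B.emb x) ![L3 u, L3 v] := by
  have hd : DifferentiableAt ℝ B.αc x := (B.contDiffAt_αc hx).differentiableAt (by simp)
  rw [← DarbouxData.extDeriv_form1_apply hd]
  have hf : DarbouxData.form1 B.αc = B.αpull := by
    funext x; rw [αpull_eq]; rfl
  rw [hf, B.extDeriv_αpull hx]

/-- The Kähler form at the base point is the exterior derivative of `α̂` within the half-space.
[folklore] -/
theorem kahlerForm_eq_extDerivWithin (a b : E4) :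
    S.kahlerForm B.p a b = extDerivWithin B.αhat (range (𝓡∂ 4)) (B.chart B.p) ![a, b] := by
  have hy : B.chart B.p ∈ (extChartAt (𝓡∂ 4) B.p).target := mem_extChartAt_target _
  have hsm : (LegendrianArc.αM S).SmoothAt ((extChartAt (𝓡∂ 4) B.p).symm (B.chart B.p)) :=
    (isSmoothForm_iff_smoothAt _).1 LegendrianArc.isSmoothForm_αM _
  have h := inChart_mextDeriv_of_mem_target (LegendrianArc.αM S) (I := 𝓡∂ 4) hy hsm
  have h2 := MForm.inChart_apply_self (mextDeriv (LegendrianArc.αM S)) (I := 𝓡∂ 4) B.p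
  have h3 : mextDeriv (LegendrianArc.αM S) B.p = extDerivWithin B.αhat (range (𝓡∂ 4)) (B.chart B.p) :=
    h2.symm.trans h
  have h4 : S.kahlerForm B.p a b = mextDeriv (LegendrianArc.αM S) B.p ![a, b] :=
    (SteinStructure.mextDeriv_liouvilleForm_apply S B.p a b).symm
  rw [h4, h3]
  rfl

/-- **The contact condition at the base point**: `dαc₀(u₁, u₀) = ω_p(V₀, J V₀)`. [folklore] -/
theorem dα_αc_zero_u₁_u₀ : dα B.αc 0 B.u₁ B.u₀ = S.kahlerForm B.p B.V₀ (S.J B.p B.V₀) := by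
  rw [B.dα_αc_eq B.zero_mem_U, L3_u₁, L3_u₀, emb_zero, kahlerForm_eq_extDerivWithin]

/-- **The contact condition**: `dαc₀(u₁, u₀) > 0` (`J`-convexity `ω(v, Jv) > 0`). [folklore] -/
theorem dα_αc_zero_u₁_u₀_pos : 0 < dα B.αc 0 B.u₁ B.u₀ := by
  rw [dα_αc_zero_u₁_u₀]; exact S.kahlerForm_self_J_pos _ B.V₀_ne_zero

end Smooth

/-! ## §2 The Legendrian arc through the base point

The arc is the integral curve through `0` of the Legendrian vector field
`Yv w = αc_w(r₀) u₁ - αc_w(u₁) r₀` — the field `Y` of `LegendrianDarbouxBox.lean` with the arc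
direction `u₁` in place of `u₀` — so that it is Legendrian by construction and leaves `0` in the
direction `αc₀(r₀) u₁`, a positive multiple of the prescribed `V₀`. -/

/-- **The Legendrian vector field** `Yv w = αc_w(r₀) u₁ - αc_w(u₁) r₀`. [folklore] -/
def Yv (w : E3) : E3 := (B.αc w B.r₀) • B.u₁ - (B.αc w B.u₁) • B.r₀

/-- `αc(Yv) = 0`. [folklore] -/
theorem αc_Yv (w : E3) : B.αc w (B.Yv w) = 0 := by
  simp only [Yv, map_sub, map_smul, smul_eq_mul]; ring

/-- `Yv 0 = αc₀(r₀) u₁`. [folklore] -/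
theorem Yv_zero : B.Yv 0 = (B.αc 0 B.r₀) • B.u₁ := by
  simp [Yv, B.αc_zero_u₁]

/-- `Yv 0 ≠ 0`. [folklore] -/
theorem Yv_zero_ne_zero : B.Yv 0 ≠ 0 := by
  rw [Yv_zero]; exact smul_ne_zero B.αc_zero_r₀_pos.ne' B.u₁_ne_zero

/-- `dα` is linear in its first vector argument. [folklore] -/
theorem dα_smul_left (α : E3 → E3 →L[ℝ] ℝ) (w u v : E3) (a : ℝ) :
    dα α w (a • u) v = a * dα α w u v := by
  simp only [dα, map_smul, smul_eq_mul]
  rw [show (a • fderiv ℝ α w u) v = a * fderiv ℝ α w u v from rfl]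
  ring

section Arc

variable [T2Space W]

/-- `Yv` is smooth on `U`. [folklore] -/
theorem contDiffOn_Yv : ContDiffOn ℝ ∞ B.Yv B.U :=
  ((B.contDiffOn_αc.clm_apply contDiffOn_const).smul contDiffOn_const).sub
    ((B.contDiffOn_αc.clm_apply contDiffOn_const).smul contDiffOn_const)

/-- A local `C^∞` flow of `Yv` near `0` (the data produced by the tree's smooth-dependence
result `Literature.Analysis.ODE.exists_contDiffOn_flow`). [folklore] -/
structure ArcFlow where
  /-- the flow `φ x t` -/
  φ : E3 → ℝ → E3
  /-- radius of initial conditions -/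
  r : ℝ
  /-- time of existence -/
  ε : ℝ
  r_pos : 0 < r
  ε_pos : 0 < ε
  φ_zero : ∀ x ∈ ball (0 : E3) r, φ x 0 = x
  hasDerivAt_φ : ∀ x ∈ ball (0 : E3) r, ∀ t ∈ Ioo (-ε) ε, HasDerivAt (φ x) (B.Yv (φ x t)) t
  φ_mem : ∀ x ∈ ball (0 : E3) r, ∀ t ∈ Ioo (-ε) ε, φ x t ∈ B.U
  contDiffOn_φ : ContDiffOn ℝ ∞ (fun p : E3 × ℝ => φ p.1 p.2) (ball (0 : E3) r ×ˢ Ioo (-ε) ε)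

/-- A local smooth flow of `Yv` exists (Lang 1995, IV §1, Thm. 1.14, the tree's
`exists_contDiffOn_flow`). [folklore] -/
theorem nonempty_arcFlow : Nonempty B.ArcFlow := by
  obtain ⟨φ, r, hr, ε, hε, h0, hd, hm, hs⟩ :=
    Literature.Analysis.ODE.exists_contDiffOn_flow (n := (⊤ : ℕ∞)) B.isOpen_U B.contDiffOn_Yv le_top
      B.zero_mem_U
  exact ⟨⟨φ, r, ε, hr, hε, h0, hd, hm, hs⟩⟩

/-- The chosen local flow of `Yv`. [folklore] -/
def afl : B.ArcFlow := Classical.choice B.nonempty_arcFlow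

/-- **The half-length `δ` of the parameter interval of the arc** (the time of existence of the
flow). [folklore] -/
def δ : ℝ := B.afl.ε

/-- `δ > 0`. [folklore] -/
theorem δ_pos : 0 < B.δ := B.afl.ε_pos

/-- The parameter interval `(-δ, δ)`. [folklore] -/
def Iv : Set ℝ := Ioo (-B.δ) B.δ

/-- The parameter interval is `(0 - δ, 0 + δ)`. [folklore] -/
theorem Iv_eq : B.Iv = Ioo (0 - B.δ) (0 + B.δ) := by rw [zero_sub, zero_add]; rfl

/-- The parameter interval is open. [folklore] -/
theorem isOpen_Iv : IsOpen B.Iv := isOpen_Ioo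

/-- `0` lies in the parameter interval. [folklore] -/
theorem zero_mem_Iv : (0 : ℝ) ∈ B.Iv := ⟨by simp [B.δ_pos], B.δ_pos⟩

/-- The parameter interval is a neighbourhood of `0`. [folklore] -/
theorem Iv_mem_nhds_zero : B.Iv ∈ 𝓝 (0 : ℝ) := B.isOpen_Iv.mem_nhds B.zero_mem_Iv

/-- **The Legendrian arc `c` through `0`**: the integral curve of `Yv` starting at `0`. [folklore] -/
def c (s : ℝ) : E3 := B.afl.φ 0 s

/-- `c 0 = 0`. [folklore] -/
@[simp] theorem c_zero : B.c 0 = 0 := B.afl.φ_zero 0 (mem_ball_self B.afl.r_pos)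

/-- The arc is an integral curve of `Yv`. [folklore] -/
theorem hasDerivAt_c {s : ℝ} (hs : s ∈ B.Iv) : HasDerivAt B.c (B.Yv (B.c s)) s :=
  B.afl.hasDerivAt_φ 0 (mem_ball_self B.afl.r_pos) s hs

/-- `ċ = Yv ∘ c`. [folklore] -/
theorem deriv_c {s : ℝ} (hs : s ∈ B.Iv) : deriv B.c s = B.Yv (B.c s) := (B.hasDerivAt_c hs).deriv

/-- The arc stays in `U`. [folklore] -/
theorem c_mem_U {s : ℝ} (hs : s ∈ B.Iv) : B.c s ∈ B.U :=
  B.afl.φ_mem 0 (mem_ball_self B.afl.r_pos) s hs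

/-- The arc is smooth on the parameter interval. [folklore] -/
theorem contDiffOn_c : ContDiffOn ℝ ∞ B.c B.Iv := by
  have h2 : ContDiffOn ℝ ∞ (fun s : ℝ => ((0 : E3), s)) B.Iv := contDiffOn_const.prodMk contDiffOn_id
  exact B.afl.contDiffOn_φ.comp h2 fun s hs => ⟨mem_ball_self B.afl.r_pos, hs⟩

/-- The arc is smooth at the points of the parameter interval. [folklore] -/
theorem contDiffAt_c {s : ℝ} (hs : s ∈ B.Iv) : ContDiffAt ℝ ∞ B.c s :=
  B.contDiffOn_c.contDiffAt (B.isOpen_Iv.mem_nhds hs)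

/-- The arc is continuous at the points of the parameter interval. [folklore] -/
theorem continuousAt_c {s : ℝ} (hs : s ∈ B.Iv) : ContinuousAt B.c s := (B.contDiffAt_c hs).continuousAt

/-- **The arc is Legendrian**: `αc_{c s}(ċ s) = 0`. [folklore] -/
theorem αc_c_deriv {s : ℝ} (hs : s ∈ B.Iv) : B.αc (B.c s) (deriv B.c s) = 0 := by
  rw [B.deriv_c hs]; exact B.αc_Yv _

/-- **`ċ(0) = αc₀(r₀) u₁`**, a positive multiple of the prescribed direction. [folklore] -/
theorem deriv_c_zero : deriv B.c 0 = (B.αc 0 B.r₀) • B.u₁ := by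
  rw [B.deriv_c B.zero_mem_Iv, c_zero, Yv_zero]

/-- `ċ(0) ≠ 0`. [folklore] -/
theorem deriv_c_zero_ne_zero : deriv B.c 0 ≠ 0 := by
  rw [B.deriv_c B.zero_mem_Iv, c_zero]; exact B.Yv_zero_ne_zero

/-- **The contact condition along the arc at the base point**:
`dαc₀(ċ(0), u₀) = αc₀(r₀) ω_p(V₀, J V₀) > 0`. [folklore] -/
theorem twist_pos : 0 < dα B.αc 0 (deriv B.c 0) B.u₀ := by
  rw [deriv_c_zero, dα_smul_left]
  exact mul_pos B.αc_zero_r₀_pos B.dα_αc_zero_u₁_u₀_pos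

/-- **The Darboux data at a base point of the boundary of a compact Stein domain** (input of the
Darboux box of `LegendrianDarbouxBox.lean`, with the integral curve `c` as its Legendrian arc and
base parameter `0`). [folklore] -/
def darbouxData : DarbouxData where
  U := B.U
  isOpen_U := B.isOpen_U
  zero_mem := B.zero_mem_U
  α := B.αc
  α_smooth := B.contDiffOn_αc
  c := B.c
  s₀ := 0
  δ := B.δ
  δ_pos := B.δ_pos
  c_smooth := by rw [← Iv_eq]; exact B.contDiffOn_c
  c_mem := fun s hs => B.c_mem_U (by rw [Iv_eq]; exact hs)
  c_s₀ := B.c_zero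
  legendrian := fun s hs => B.αc_c_deriv (by rw [Iv_eq]; exact hs)
  u₀ := B.u₀
  r₀ := B.r₀
  α_u₀ := B.αc_zero_u₀
  α_r₀ := B.αc_zero_r₀_pos
  twist := B.twist_pos

/-- Unfolding. [folklore] -/
@[simp] theorem darbouxData_U : B.darbouxData.U = B.U := rfl

/-- Unfolding. [folklore] -/
@[simp] theorem darbouxData_α : B.darbouxData.α = B.αc := rfl

/-- Unfolding. [folklore] -/
@[simp] theorem darbouxData_c : B.darbouxData.c = B.c := rfl

/-- Unfolding. [folklore] -/
@[simp] theorem darbouxData_s₀ : B.darbouxData.s₀ = 0 := rfl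

/-- Unfolding. [folklore] -/
@[simp] theorem darbouxData_δ : B.darbouxData.δ = B.δ := rfl

/-- Unfolding. [folklore] -/
@[simp] theorem darbouxData_u₀ : B.darbouxData.u₀ = B.u₀ := rfl

/-- Unfolding. [folklore] -/
@[simp] theorem darbouxData_r₀ : B.darbouxData.r₀ = B.r₀ := rfl

end Arc

/-! ## §3 The chart-`p` dictionary at a base point

(`LegendrianStabilisation.lean`, Part 1, for a base point instead of a Legendrian knot.) -/

/-- The point of `W` with chart-`p` coordinates `y`. [folklore] -/
def pt (y : E4) : W := B.chart.symm y

/-- **`M y`**: the derivative within the half-space of the inverse extended chart at `p`, at the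
point `y` of its target; it produces tangent vectors at `pt y` from chart-`p` coordinates.
[folklore] -/
def M (y : E4) : E4 →L[ℝ] E4 :=
  mfderivWithin 𝓘(ℝ, E4) (𝓡∂ 4) B.chart.symm (range (𝓡∂ 4)) y

/-- `pt (chart p) = p`. [folklore] -/
@[simp] theorem pt_chart_p : B.pt (B.chart B.p) = B.p := extChartAt_to_inv (I := 𝓡∂ 4) B.p

/-- `pt y` lies in the chart domain of `p`. [folklore] -/
theorem pt_mem_source {y : E4} (hy : y ∈ B.chart.target) :
    B.pt y ∈ (chartAt (EuclideanHalfSpace 4) B.p).source := by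
  rw [← extChartAt_source (I := 𝓡∂ 4)]; exact B.chart.map_target hy

/-- `pt y` lies in the extended chart domain of `p`. [folklore] -/
theorem pt_mem_extSource {y : E4} (hy : y ∈ B.chart.target) :
    B.pt y ∈ (extChartAt (𝓡∂ 4) B.p).source :=
  B.chart.map_target hy

/-- `chart (pt y) = y`. [folklore] -/
theorem chart_pt {y : E4} (hy : y ∈ B.chart.target) : B.chart (B.pt y) = y := B.chart.right_inv hy

/-- `M y` is the tangent coordinate change from the chart at `p` to the chart at `pt y`.
[folklore] -/
theorem M_eq_tangentCoordChange {y : E4} (hy : y ∈ B.chart.target) :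
    B.M y = tangentCoordChange (𝓡∂ 4) B.p (B.pt y) (B.pt y) :=
  mfderivWithin_extChartAt_symm_eq_tangentCoordChange hy

/-- **`M (chart p)` is the identity.** [folklore] -/
theorem M_chart_p_apply (X : E4) : B.M (B.chart B.p) X = X := by
  have hy : B.chart B.p ∈ B.chart.target := mem_extChartAt_target (I := 𝓡∂ 4) B.p
  rw [B.M_eq_tangentCoordChange hy, pt_chart_p, tangentCoordChange_self (mem_extChartAt_source _)]

/-- Reading `M y X̂` back in the chart at `p` returns `X̂`. [folklore] -/
theorem tangentCoordChange_M {y : E4} (hy : y ∈ B.chart.target) (X : E4) :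
    tangentCoordChange (𝓡∂ 4) (B.pt y) B.p (B.pt y) (B.M y X) = X := by
  rw [B.M_eq_tangentCoordChange hy]
  have hmem : B.pt y ∈ (extChartAt (𝓡∂ 4) B.p).source ∩ (extChartAt (𝓡∂ 4) (B.pt y)).source ∩
      (extChartAt (𝓡∂ 4) B.p).source :=
    ⟨⟨B.pt_mem_extSource hy, mem_extChartAt_source _⟩, B.pt_mem_extSource hy⟩
  rw [tangentCoordChange_comp hmem, tangentCoordChange_self (B.pt_mem_extSource hy)]

/-- `M y` applied to the chart-`p` reading of a tangent vector at `pt y` returns the vector.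
[folklore] -/
theorem M_tangentCoordChange {y : E4} (hy : y ∈ B.chart.target) (X : E4) :
    B.M y (tangentCoordChange (𝓡∂ 4) (B.pt y) B.p (B.pt y) X) = X := by
  rw [B.M_eq_tangentCoordChange hy]
  have hmem : B.pt y ∈ (extChartAt (𝓡∂ 4) (B.pt y)).source ∩ (extChartAt (𝓡∂ 4) B.p).source ∩
      (extChartAt (𝓡∂ 4) (B.pt y)).source :=
    ⟨⟨mem_extChartAt_source _, B.pt_mem_extSource hy⟩, mem_extChartAt_source _⟩
  rw [tangentCoordChange_comp hmem, tangentCoordChange_self (mem_extChartAt_source _)]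

/-- `M y` is injective. [folklore] -/
theorem M_injective {y : E4} (hy : y ∈ B.chart.target) : Injective (B.M y) := fun X₁ X₂ h => by
  have := congrArg (tangentCoordChange (𝓡∂ 4) (B.pt y) B.p (B.pt y)) h
  rwa [B.tangentCoordChange_M hy, B.tangentCoordChange_M hy] at this

/-- A point with vanishing `0`-th chart-`p` coordinate is a boundary point. [folklore] -/
theorem isBoundaryPoint_pt {y : E4} (hy : y ∈ B.chart.target) (hy0 : y 0 = 0) :
    (𝓡∂ 4).IsBoundaryPoint (B.pt y) :=
  (isBoundaryPoint_iff_apply_zero (B.pt_mem_source hy)).2 (by rw [← chart]; rw [B.chart_pt hy]; exact hy0)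

/-- `φ` is at its maximum at the points of the hyperplane. [folklore] -/
theorem φ_pt_eq {q : E4} (hq : q ∈ B.chart.target) (hq0 : q 0 = 0) :
    S.φ (B.pt q) = sSup (range S.φ) :=
  (S.boundary_eq _).1 (B.isBoundaryPoint_pt hq hq0)

/-- **`M y` identifies the hyperplane `{X̂₀ = 0}` with the tangent space of the boundary**: for a
point `y` of the hyperplane, `(M y X̂) ∈ T∂W ⇔ X̂ 0 = 0`. [folklore] -/
theorem M_apply_zero_iff {y : E4} (hy : y ∈ B.chart.target) (hy0 : y 0 = 0) (X : E4) :
    (B.M y X) 0 = 0 ↔ X 0 = 0 := by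
  have hz : (𝓡∂ 4).IsBoundaryPoint (B.pt y) := B.isBoundaryPoint_pt hy hy0
  rw [← S.mfderiv_φ_apply_eq_zero_iff hz]
  set L : E4 →L[ℝ] ℝ := (S.dφ (B.pt y) : E4 →L[ℝ] ℝ).comp (B.M y) with hL
  -- `L` is the derivative of `φ ∘ chart.symm` within the half-space at `y`
  have hφd : HasMFDerivAt (𝓡∂ 4) 𝓘(ℝ, ℝ) S.φ (B.pt y) (S.dφ (B.pt y)) :=
    (S.φ_smooth.mdifferentiableAt (by simp)).hasMFDerivAt
  have hsymm : HasMFDerivWithinAt 𝓘(ℝ, E4) (𝓡∂ 4) B.chart.symm (range (𝓡∂ 4)) y (B.M y) :=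
    (mdifferentiableWithinAt_extChartAt_symm hy).hasMFDerivWithinAt
  have hcomp := hφd.comp_hasMFDerivWithinAt y hsymm
  have hF : HasFDerivWithinAt (S.φ ∘ B.chart.symm) L (range (𝓡∂ 4)) y :=
    hasMFDerivWithinAt_iff_hasFDerivWithinAt.1 hcomp
  -- restrict to the hyperplane, where `φ ∘ chart.symm` is constant near `y`
  set H : Set E4 := {q | q 0 = 0} with hH
  have hHsub : H ⊆ range (𝓡∂ 4) := fun q hq => by
    rw [range_modelWithCornersEuclideanHalfSpace]; exact le_of_eq (Eq.symm hq)
  have hconst : ∀ᶠ q in 𝓝[H] y, (S.φ ∘ B.chart.symm) q = sSup (range S.φ) := by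
    have h1 : ∀ᶠ q in 𝓝[H] y, q ∈ B.chart.target :=
      nhdsWithin_mono y hHsub (extChartAt_target_mem_nhdsWithin_of_mem hy)
    filter_upwards [h1, self_mem_nhdsWithin] with q hq hqH
    exact B.φ_pt_eq hq hqH
  have hZ : HasFDerivWithinAt (S.φ ∘ B.chart.symm) (0 : E4 →L[ℝ] ℝ) H y :=
    (hasFDerivWithinAt_const _ y H).congr_of_eventuallyEq hconst (B.φ_pt_eq hy hy0)
  have huniq := (hF.mono hHsub).unique_on hZ
  have hker : ∀ V : E4, V 0 = 0 → L V = 0 := fun V hV =>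
    huniq (mem_tangentConeAt_hyperplane hy0 hV)
  -- `L ≠ 0`
  have hLne : L ≠ 0 := by
    intro h0
    apply S.regular _ hz
    ext X'
    have h := DFunLike.congr_fun h0 (tangentCoordChange (𝓡∂ 4) (B.pt y) B.p (B.pt y) X')
    rw [hL, ContinuousLinearMap.comp_apply, B.M_tangentCoordChange hy] at h
    exact h
  change L X = 0 ↔ X 0 = 0
  refine ⟨fun h => ?_, hker X⟩
  by_contra hX0
  apply hLne
  ext w
  set c : ℝ := w 0 / X 0
  have hw : (w - c • X) 0 = 0 := by
    rw [PiLp.sub_apply, PiLp.smul_apply, smul_eq_mul, div_mul_cancel₀ _ hX0, sub_self]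
  have := hker _ hw
  rwa [map_sub, map_smul, h, smul_zero, sub_zero] at this

/-- **The contact form through the chart at `p`**: `α_{pt y}(M y V̂) = α̂_y(V̂)`. [folklore] -/
theorem contactForm_M (y : E4) (V : E4) :
    S.contactForm (B.pt y) (B.M y V) = B.αhat y ![V] := by
  show _ = ((LegendrianArc.αM S).inChart B.p) y ![V]
  rw [MForm.inChart_apply, ← LegendrianArc.αM_apply]
  unfold pt M chart
  congr 1
  funext i; fin_cases i; rfl

section SmoothCalc

variable [T2Space W]

/-- **The Kähler form through the chart at `p`**: `ω_{pt y}(M y Û, M y V̂) = (dα̂)_y(Û, V̂)`, the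
exterior derivative within the half-space of the chart representative. [folklore] -/
theorem kahlerForm_M {y : E4} (hy : y ∈ B.chart.target) (U V : E4) :
    S.kahlerForm (B.pt y) (B.M y U) (B.M y V) =
      extDerivWithin B.αhat (range (𝓡∂ 4)) y ![U, V] := by
  have hsm : (LegendrianArc.αM S).SmoothAt ((extChartAt (𝓡∂ 4) B.p).symm y) :=
    (isSmoothForm_iff_smoothAt _).1 LegendrianArc.isSmoothForm_αM _
  have h := inChart_mextDeriv_of_mem_target (LegendrianArc.αM S) (I := 𝓡∂ 4) hy hsm
  have h4 : S.kahlerForm (B.pt y) (B.M y U) (B.M y V) =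
      mextDeriv (LegendrianArc.αM S) (B.pt y) ![B.M y U, B.M y V] :=
    (SteinStructure.mextDeriv_liouvilleForm_apply S _ _ _).symm
  rw [h4]
  change _ = extDerivWithin ((LegendrianArc.αM S).inChart B.p) (range (𝓡∂ 4)) y ![U, V]
  rw [← h, MForm.inChart_apply]
  unfold pt M chart
  congr 1
  funext i; fin_cases i <;> rfl

/-! ### The Darboux box at the base point, read in `W` -/

/-- **The box frame as a linear map**: `bvL w = M (emb (Ψ w)) ∘ L3 ∘ DΨ_w`. [folklore] -/
def bvL (w : E3) : E3 →L[ℝ] E4 :=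
  (B.M (B.emb (B.darbouxData.Ψ w))).comp (L3.comp (fderiv ℝ B.darbouxData.Ψ w))

/-- **The box frame.** The tangent vector at the point `pt (emb (Ψ w))` with box coordinates `ξ`:
`bv w ξ = M (emb (Ψ w)) (L3 (DΨ_w ξ))`. [folklore] -/
def bv (w ξ : E3) : E4 := B.M (B.emb (B.darbouxData.Ψ w)) (L3 (fderiv ℝ B.darbouxData.Ψ w ξ))

/-- `bvL w ξ = bv w ξ`. [folklore] -/
@[simp] theorem bvL_apply (w ξ : E3) : B.bvL w ξ = B.bv w ξ := rfl

/-- **The box map** `bpt = chart⁻¹ ∘ emb ∘ Ψ : ℝ³ ⊇ V → W`. [folklore] -/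
def bpt (w : E3) : W := B.pt (B.emb (B.darbouxData.Ψ w))

/-- Unfolding `bpt`. [folklore] -/
theorem bpt_eq (w : E3) : B.bpt w = B.chart.symm (B.emb (B.darbouxData.Ψ w)) := rfl

/-- Points of the box are chart points. [folklore] -/
theorem emb_Ψ_mem_target {w : E3} (hw : w ∈ B.darbouxData.V) :
    B.emb (B.darbouxData.Ψ w) ∈ B.chart.target :=
  DarbouxData.Ψ_mem_U (hw := hw)

/-- **`α` on the box frame**: `α(bv w ξ) = g(w) (ξ₂ - w₁ ξ₀)`, i.e. `bpt^*α = g (dz - y dx)`.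
[folklore] -/
theorem contactForm_bv {w : E3} (hw : w ∈ B.darbouxData.V) (ξ : E3) :
    S.contactForm (B.bpt w) (B.bv w ξ) = B.darbouxData.g w * (ξ 2 - w 1 * ξ 0) := by
  rw [bpt, bv, contactForm_M, ← αc_apply, ← darbouxData_α, DarbouxData.α_Ψ_fderiv _ hw]

/-- **`ω` on the box frame**: the formula of `DarbouxData.dα_Ψ_fderiv`, i.e.
`bpt^*ω = d(g (dz - y dx))`. [folklore] -/
theorem kahlerForm_bv {w : E3} (hw : w ∈ B.darbouxData.V) (ξ η : E3) :
    S.kahlerForm (B.bpt w) (B.bv w ξ) (B.bv w η) =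
      B.darbouxData.g w * (ξ 0 * η 1 - ξ 1 * η 0) +
        fderiv ℝ B.darbouxData.g w ξ * (η 2 - w 1 * η 0) -
        fderiv ℝ B.darbouxData.g w η * (ξ 2 - w 1 * ξ 0) := by
  rw [bpt, bv, bv, B.kahlerForm_M (B.emb_Ψ_mem_target hw), ← B.dα_αc_eq (DarbouxData.Ψ_mem_U (hw := hw)),
    ← darbouxData_α, DarbouxData.dα_Ψ_fderiv _ hw]

/-- The box frame is tangent to the boundary. [folklore] -/
theorem bv_apply_zero {w : E3} (hw : w ∈ B.darbouxData.V) (ξ : E3) : B.bv w ξ 0 = 0 :=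
  (B.M_apply_zero_iff (B.emb_Ψ_mem_target hw) (B.emb_apply_zero _) _).2 (by simp [L3])

/-- The box frame read back in the chart at `p`. [folklore] -/
theorem tangentCoordChange_bv {w : E3} (hw : w ∈ B.darbouxData.V) (ξ : E3) :
    tangentCoordChange (𝓡∂ 4) (B.bpt w) B.p (B.bpt w) (B.bv w ξ) =
      L3 (fderiv ℝ B.darbouxData.Ψ w ξ) :=
  B.tangentCoordChange_M (B.emb_Ψ_mem_target hw) _

/-- The box frame is injective in the box coordinates. [folklore] -/
theorem bv_injective {w : E3} (hw : w ∈ B.darbouxData.V) : Injective (B.bv w) := fun ξ₁ ξ₂ h => by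
  have h1 := congrArg (tangentCoordChange (𝓡∂ 4) (B.bpt w) B.p (B.bpt w)) h
  rw [B.tangentCoordChange_bv hw, B.tangentCoordChange_bv hw] at h1
  exact DarbouxData.fderiv_Ψ_injective (hw := hw) (L3_injective h1)

/-- The box frame is linear in the box coordinates. [folklore] -/
theorem bv_smul {w : E3} (c : ℝ) (ξ : E3) : B.bv w (c • ξ) = c • B.bv w ξ := by
  simp only [bv, map_smul]

/-- **The box frame spans complex tangencies exactly on `ker (dz - y dx)`**: `bv w ξ ∈ ξ_{bpt w}`
iff `ξ₂ = w₁ ξ₀`. [folklore] -/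
theorem bv_mem_contactPlane_iff {w : E3} (hw : w ∈ B.darbouxData.V) (ξ : E3) :
    B.bv w ξ ∈ contactPlane S.J (B.bpt w) ↔ ξ 2 = w 1 * ξ 0 := by
  have hb : (𝓡∂ 4).IsBoundaryPoint (B.bpt w) :=
    B.isBoundaryPoint_pt (B.emb_Ψ_mem_target hw) (B.emb_apply_zero _)
  constructor
  · intro h
    have h1 := S.contactForm_apply_eq_zero hb h
    rw [B.contactForm_bv hw] at h1
    rcases mul_eq_zero.1 h1 with h2 | h2
    · exact absurd h2 (DarbouxData.g_pos (hw := hw)).ne'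
    · linarith
  · intro h
    refine S.mem_contactPlane_of_contactForm_eq_zero hb (B.bv_apply_zero hw ξ) ?_
    rw [B.contactForm_bv hw, h, sub_self, mul_zero]

/-- The points of the box are boundary points. [folklore] -/
theorem isBoundaryPoint_bpt {w : E3} (hw : w ∈ B.darbouxData.V) :
    (𝓡∂ 4).IsBoundaryPoint (B.bpt w) :=
  B.isBoundaryPoint_pt (B.emb_Ψ_mem_target hw) (B.emb_apply_zero _)

/-- `Ψ 0 = 0`. [folklore] -/
theorem Ψ_zero : B.darbouxData.Ψ 0 = 0 := by
  have h := B.darbouxData.Ψ_axis (x := 0) (by rw [zero_smul]; exact B.darbouxData.zero_mem_V₀)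
    (by rw [zero_smul]; exact B.darbouxData.zero_mem_Φ₁_source)
  rw [zero_smul, darbouxData_s₀, add_zero, darbouxData_c] at h
  rw [h, c_zero]

/-- **The box is centred at the base point**: `bpt 0 = p`. [folklore] -/
@[simp] theorem bpt_zero : B.bpt 0 = B.p := by
  rw [bpt, Ψ_zero, emb_zero, pt_chart_p]

/-- The box map is injective on `V`. [folklore] -/
theorem injOn_bpt : InjOn B.bpt B.darbouxData.V := by
  intro w₁ h₁ w₂ h₂ h
  have h' : B.emb (B.darbouxData.Ψ w₁) = B.emb (B.darbouxData.Ψ w₂) :=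
    B.chart.symm.injOn (B.emb_Ψ_mem_target h₁) (B.emb_Ψ_mem_target h₂) h
  exact B.darbouxData.injOn_Ψ h₁ h₂ (B.emb_injective h')

/-- The inner map `emb ∘ Ψ` is differentiable at the points of `V`, with derivative `L3 ∘ DΨ`.
[folklore] -/
theorem hasFDerivAt_emb_Ψ {w : E3} (hw : w ∈ B.darbouxData.V) :
    HasFDerivAt (fun w => B.emb (B.darbouxData.Ψ w)) (L3.comp (fderiv ℝ B.darbouxData.Ψ w)) w :=
  (B.hasFDerivAt_emb _).comp w (B.darbouxData.hasFDerivAt_Ψ hw).differentiableAt.hasFDerivAt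

/-- **The box frame is the differential of the box map**: `D(bpt)_w = bvL w`. [folklore] -/
theorem hasMFDerivAt_bpt {w : E3} (hw : w ∈ B.darbouxData.V) :
    HasMFDerivAt 𝓘(ℝ, E3) (𝓡∂ 4) B.bpt w (B.bvL w) := by
  have hy := B.emb_Ψ_mem_target hw
  have hsymm : HasMFDerivWithinAt 𝓘(ℝ, E4) (𝓡∂ 4) B.chart.symm (range (𝓡∂ 4))
      (B.emb (B.darbouxData.Ψ w)) (B.M (B.emb (B.darbouxData.Ψ w))) :=
    (mdifferentiableWithinAt_extChartAt_symm hy).hasMFDerivWithinAt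
  have hin : HasMFDerivWithinAt 𝓘(ℝ, E3) 𝓘(ℝ, E4) (fun w => B.emb (B.darbouxData.Ψ w)) univ w
      (L3.comp (fderiv ℝ B.darbouxData.Ψ w)) :=
    (hasMFDerivAt_iff_hasFDerivAt.2 (B.hasFDerivAt_emb_Ψ hw)).hasMFDerivWithinAt
  have hmaps : univ ⊆ (fun w => B.emb (B.darbouxData.Ψ w)) ⁻¹' (range (𝓡∂ 4)) :=
    fun x _ => B.emb_mem_range _
  have h := hsymm.comp w hin hmaps
  exact hasMFDerivWithinAt_univ.1 h

/-- The differential of the box map. [folklore] -/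
theorem mfderiv_bpt {w : E3} (hw : w ∈ B.darbouxData.V) :
    mfderiv 𝓘(ℝ, E3) (𝓡∂ 4) B.bpt w = B.bvL w :=
  (B.hasMFDerivAt_bpt hw).mfderiv

/-- **The box map is `C^∞` on `V`.** [folklore] -/
theorem contMDiffOn_bpt : ContMDiffOn 𝓘(ℝ, E3) (𝓡∂ 4) ∞ B.bpt B.darbouxData.V := by
  have h1 : ContMDiffOn 𝓘(ℝ, E3) 𝓘(ℝ, E4) ∞ (fun w => B.emb (B.darbouxData.Ψ w)) B.darbouxData.V := by
    rw [contMDiffOn_iff_contDiffOn]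
    exact fun w hw => (B.contDiff_emb.contDiffAt.comp w (B.darbouxData.contDiffAt_Ψ hw)).contDiffWithinAt
  exact (contMDiffOn_extChartAt_symm (I := 𝓡∂ 4) B.p).comp h1 fun w hw => B.emb_Ψ_mem_target hw

/-- The box map is continuous on `V`. [folklore] -/
theorem continuousOn_bpt : ContinuousOn B.bpt B.darbouxData.V := B.contMDiffOn_bpt.continuousOn

/-! ### The Legendrian arc read in `W` -/

/-- **The Legendrian arc in `W`**: `arc s = bpt (s, 0, 0)` (`= chart⁻¹ (emb (c s))` on the axis
of the box). [folklore] -/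
def arc (s : ℝ) : W := B.bpt (s • DarbouxData.e 0)

/-- **Its velocity** `arc' s = bv (s, 0, 0) e₀`. [folklore] -/
def arcVel (s : ℝ) : E4 := B.bv (s • DarbouxData.e 0) (DarbouxData.e 0)

/-- `arc 0 = p`. [folklore] -/
@[simp] theorem arc_zero : B.arc 0 = B.p := by rw [arc, zero_smul, bpt_zero]

/-- The line `s ↦ (s, 0, 0)` has derivative `e₀`. [folklore] -/
theorem hasMFDerivAt_axis (s : ℝ) :
    HasMFDerivAt 𝓘(ℝ, ℝ) 𝓘(ℝ, E3) (fun s : ℝ => s • (DarbouxData.e 0 : E3)) s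
      ((1 : ℝ →L[ℝ] ℝ).smulRight (DarbouxData.e 0)) := by
  have h : HasFDerivAt (fun s : ℝ => s • (DarbouxData.e 0 : E3))
      ((1 : ℝ →L[ℝ] ℝ).smulRight (DarbouxData.e 0)) s := by
    have h0 := ((1 : ℝ →L[ℝ] ℝ).smulRight (DarbouxData.e 0 : E3)).hasFDerivAt (x := s)
    have he : (fun s : ℝ => s • (DarbouxData.e 0 : E3)) = ⇑((1 : ℝ →L[ℝ] ℝ).smulRight (DarbouxData.e 0 : E3)) := by
      funext t; simp
    rw [he]; exact h0
  exact hasMFDerivAt_iff_hasFDerivAt.2 h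

/-- **The velocity is the derivative of the arc.** [folklore] -/
theorem hasMFDerivAt_arc {s : ℝ} (hs : (s • DarbouxData.e 0 : E3) ∈ B.darbouxData.V) :
    HasMFDerivAt 𝓘(ℝ, ℝ) (𝓡∂ 4) B.arc s ((1 : ℝ →L[ℝ] ℝ).smulRight (B.arcVel s)) := by
  have h := HasMFDerivAt.comp s (g := B.bpt) (f := fun s : ℝ => s • (DarbouxData.e 0 : E3))
    (B.hasMFDerivAt_bpt hs) (hasMFDerivAt_axis s)
  have he : (B.bvL (s • DarbouxData.e 0)).comp ((1 : ℝ →L[ℝ] ℝ).smulRight (DarbouxData.e 0)) =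
      (1 : ℝ →L[ℝ] ℝ).smulRight (B.arcVel s) := by
    apply ContinuousLinearMap.ext_ring
    simp [arcVel]
  exact h.congr_mfderiv he

/-- The arc lies in the boundary. [folklore] -/
theorem isBoundaryPoint_arc {s : ℝ} (hs : (s • DarbouxData.e 0 : E3) ∈ B.darbouxData.V) :
    (𝓡∂ 4).IsBoundaryPoint (B.arc s) :=
  B.isBoundaryPoint_bpt hs

/-- **The arc is Legendrian**: its velocity is a complex tangency. [folklore] -/
theorem arcVel_mem_contactPlane {s : ℝ} (hs : (s • DarbouxData.e 0 : E3) ∈ B.darbouxData.V) :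
    B.arcVel s ∈ contactPlane S.J (B.arc s) :=
  (B.bv_mem_contactPlane_iff hs _).2 (by simp [DarbouxData.e_apply])

/-- The velocity never vanishes. [folklore] -/
theorem arcVel_ne_zero {s : ℝ} (hs : (s • DarbouxData.e 0 : E3) ∈ B.darbouxData.V) : B.arcVel s ≠ 0 := by
  intro h
  have h1 : B.bv (s • DarbouxData.e 0) (DarbouxData.e 0) = B.bv (s • DarbouxData.e 0) 0 := by
    rw [show B.bv (s • DarbouxData.e 0) 0 = 0 by simp [bv]]; exact h
  have h2 := B.bv_injective hs h1
  have h3 : (DarbouxData.e 0 : E3) 0 = (0 : E3) 0 := by rw [h2]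
  rw [DarbouxData.e_apply] at h3
  simp at h3

/-- **The arc leaves `p` in the prescribed direction**: `arc' 0 = αc₀(r₀) • V₀`, a positive multiple
of `V₀`. [folklore] -/
theorem arcVel_zero : B.arcVel 0 = (B.αc 0 B.r₀) • B.V₀ := by
  have hV : ((0 : ℝ) • DarbouxData.e 0 : E3) ∈ B.darbouxData.V := by
    rw [zero_smul]; exact B.darbouxData.zero_mem_V
  have hV₀ : ((0 : ℝ) • DarbouxData.e 0 : E3) ∈ B.darbouxData.V₀ := by
    rw [zero_smul]; exact B.darbouxData.zero_mem_V₀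
  have hΦ : ((0 : ℝ) • DarbouxData.e 0 : E3) ∈ B.darbouxData.Φ₁.source := by
    rw [zero_smul]; exact B.darbouxData.zero_mem_Φ₁_source
  have h1 := B.darbouxData.fderiv_Ψ_e0_axis hV hV₀ hΦ
  rw [arcVel, bv, h1]
  simp only [zero_smul, darbouxData_s₀, add_zero, darbouxData_c, Ψ_zero, emb_zero, deriv_c_zero,
    map_smul, L3_u₁, M_chart_p_apply]

end SmoothCalc

end BasePoint

/-! ## §4 Darboux's theorem and Legendrian arcs in `W`, packaged -/

section Packaged

variable [T2Space W]

/-- **Darboux's theorem for the contact boundary of a compact Stein domain** (Geiges 2008,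
Thm. 2.5.1, conformal form).  Every boundary point `p` of a compact Stein domain `(W, J, φ)` is the
centre `ψ 0 = p` of a box map `ψ : ℝ³ ⊇ V → W` (`V` an open neighbourhood of `0`) which is `C^∞`,
injective, takes values in `∂W`, has injective differential `Dψ_w` with values in `T∂W`, and in
which the contact form `α = -d^ℂφ|_{T∂W}` and the Kähler form `ω = dα` read
`ψ^*α = g (dz - y dx)`, `ψ^*ω = d(g (dz - y dx))` with `g > 0` smooth:
`α(Dψ_w ξ) = g(w) (ξ₂ - w₁ ξ₀)` and
`ω(Dψ_w ξ, Dψ_w η) = g(w) (ξ₀η₁ - ξ₁η₀) + Dg_w(ξ) (η₂ - w₁η₀) - Dg_w(η) (ξ₂ - w₁ξ₀)`.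
(The box is `BasePoint.bpt` of the base point structure `BasePoint.ofBoundaryPoint S hp`.)
[folklore] -/
theorem _root_.Literature.Geometry.Symplectic.SteinStructure.exists_darbouxChart
    (S : SteinStructure W) {p : W} (hp : (𝓡∂ 4).IsBoundaryPoint p) :
    ∃ (V : Set E3) (ψ : E3 → W) (Dψ : E3 → E3 →L[ℝ] E4) (g : E3 → ℝ),
      IsOpen V ∧ (0 : E3) ∈ V ∧ ψ 0 = p ∧ ContMDiffOn 𝓘(ℝ, E3) (𝓡∂ 4) ∞ ψ V ∧ InjOn ψ V ∧
      (∀ w ∈ V, (𝓡∂ 4).IsBoundaryPoint (ψ w)) ∧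
      (∀ w ∈ V, HasMFDerivAt 𝓘(ℝ, E3) (𝓡∂ 4) ψ w (Dψ w)) ∧
      (∀ w ∈ V, Injective (Dψ w)) ∧
      (∀ w ∈ V, ∀ ξ : E3, Dψ w ξ 0 = 0) ∧
      (∀ w ∈ V, 0 < g w) ∧ (∀ w ∈ V, ContDiffAt ℝ ∞ g w) ∧
      (∀ w ∈ V, ∀ ξ : E3, S.contactForm (ψ w) (Dψ w ξ) = g w * (ξ 2 - w 1 * ξ 0)) ∧
      (∀ w ∈ V, ∀ ξ η : E3, S.kahlerForm (ψ w) (Dψ w ξ) (Dψ w η) =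
        g w * (ξ 0 * η 1 - ξ 1 * η 0) + fderiv ℝ g w ξ * (η 2 - w 1 * η 0) -
          fderiv ℝ g w η * (ξ 2 - w 1 * ξ 0)) := by
  set B := BasePoint.ofBoundaryPoint S hp
  exact ⟨B.darbouxData.V, B.bpt, B.bvL, B.darbouxData.g, B.darbouxData.isOpen_V,
    B.darbouxData.zero_mem_V, B.bpt_zero, B.contMDiffOn_bpt, B.injOn_bpt,
    fun w hw => B.isBoundaryPoint_bpt hw, fun w hw => B.hasMFDerivAt_bpt hw,
    fun w hw => B.bv_injective hw, fun w hw ξ => B.bv_apply_zero hw ξ,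
    fun w hw => DarbouxData.g_pos (hw := hw), fun w hw => DarbouxData.contDiffAt_g (hw := hw),
    fun w hw ξ => B.contactForm_bv hw ξ, fun w hw ξ η => B.kahlerForm_bv hw ξ η⟩

/-- **Legendrian arcs through every point in every direction.**  Through every boundary point `p`
of a compact Stein domain and tangent to every non-zero complex tangency `V₀ ∈ ξ_p` there passes a
Legendrian arc: a `C^∞` injective curve `γ : (-ℓ, ℓ) → ∂W` with `γ 0 = p`, non-vanishing velocity
`γ' s ∈ ξ_{γ s}` and `γ' 0 = a V₀`, `a > 0` (the axis of the Darboux box of the base point structure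
`⟨p, V₀⟩`; Geiges 2008, §3.1: Legendrian curves are the integral curves of Legendrian line fields).
[folklore] -/
theorem _root_.Literature.Geometry.Symplectic.SteinStructure.exists_legendrianArc
    (S : SteinStructure W) {p : W} (hp : (𝓡∂ 4).IsBoundaryPoint p) {V₀ : E4}
    (hV₀ : V₀ ∈ contactPlane S.J p) (hne : V₀ ≠ 0) :
    ∃ (γ : ℝ → W) (γ' : ℝ → E4) (ℓ a : ℝ), 0 < ℓ ∧ 0 < a ∧ γ 0 = p ∧ γ' 0 = a • V₀ ∧
      ContMDiffOn 𝓘(ℝ, ℝ) (𝓡∂ 4) ∞ γ (Ioo (-ℓ) ℓ) ∧ InjOn γ (Ioo (-ℓ) ℓ) ∧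
      (∀ s ∈ Ioo (-ℓ) ℓ, HasMFDerivAt 𝓘(ℝ, ℝ) (𝓡∂ 4) γ s ((1 : ℝ →L[ℝ] ℝ).smulRight (γ' s))) ∧
      (∀ s ∈ Ioo (-ℓ) ℓ, (𝓡∂ 4).IsBoundaryPoint (γ s)) ∧
      (∀ s ∈ Ioo (-ℓ) ℓ, γ' s ∈ contactPlane S.J (γ s)) ∧
      (∀ s ∈ Ioo (-ℓ) ℓ, γ' s ≠ 0) := by
  set B : BasePoint S := ⟨p, hp, V₀, hV₀, hne⟩
  obtain ⟨ℓ, hℓ, -, haxis⟩ := B.darbouxData.exists_box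
  have hmem : ∀ s ∈ Ioo (-ℓ) ℓ, (s • DarbouxData.e 0 : E3) ∈ B.darbouxData.V := fun s hs =>
    (haxis s (abs_lt.2 ⟨hs.1, hs.2⟩)).1
  refine ⟨B.arc, B.arcVel, ℓ, B.αc 0 B.r₀, hℓ, B.αc_zero_r₀_pos, B.arc_zero, B.arcVel_zero, ?_, ?_,
    fun s hs => B.hasMFDerivAt_arc (hmem s hs), fun s hs => B.isBoundaryPoint_arc (hmem s hs),
    fun s hs => B.arcVel_mem_contactPlane (hmem s hs), fun s hs => B.arcVel_ne_zero (hmem s hs)⟩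
  · have h1 : ContMDiffOn 𝓘(ℝ, ℝ) 𝓘(ℝ, E3) ∞ (fun s : ℝ => s • (DarbouxData.e 0 : E3)) (Ioo (-ℓ) ℓ) :=
      (contDiff_id.smul contDiff_const).contMDiff.contMDiffOn
    exact B.contMDiffOn_bpt.comp h1 fun s hs => hmem s hs
  · intro s₁ h₁ s₂ h₂ h
    have h3 := B.injOn_bpt (hmem s₁ h₁) (hmem s₂ h₂) h
    have h4 : (s₁ • DarbouxData.e 0 : E3) 0 = (s₂ • DarbouxData.e 0 : E3) 0 := by rw [h3]
    simpa [DarbouxData.e_apply] using h4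

end Packaged

end LegendrianDarboux

end Literature.Geometry.Symplectic

end
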